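import Summits.CriticalPhenomena.SAWScalingLimit.Theorems.SAWRenewalTightnessSubseqIdentificationTiltedBracketInterior
import Summits.CriticalPhenomena.SAWScalingLimit.Theorems.SAWRenewalTightnessSubseqIdentificationTiltedBracketEstimate
import Summits.CriticalPhenomena.SAWScalingLimit.Theorems.SAWRenewalTightnessSubseqIdentificationTiltedProductInterior
import HarnessLib

/-!
# The tilted martingale identities (line `boundary-area-law`, RS5b′/T2, Σ): `((Mⁿ)² − κ Cⁿ) · Lᵏ` is a martingale

Line `boundary-area-law` of the crux `SubseqIdentification` (stmt-CriticalPhenomena-0783), restriction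
reshape (lead c4, r-c4-5), **stub `stub_tiltedBracketMartingale` (Σ)** = the bracket half of step (T2)
of the tilted [LSW] Theorem 6.5 (G. F. Lawler, O. Schramm, W. Werner, *Conformal restriction: the chordal
case*, J. Amer. Math. Soc. **16** (2003), §5 (5.1)–(5.3) and Prop. 5.3): for `0 < κ ≤ 8/3`,
`α = (6−κ)/(2κ)`, `λ = (8−3κ)(6−κ)/(2κ)`, a nonempty `*`-hull `A` and levels `n ≤ k`, **the product
`Zⁿ · Lᵏ` of the compensated square `Zⁿ = (Mⁿ)² − κ Cⁿ` of the localised image driving function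
`Mⁿ = imgMartK κ hA hne n` (`h_t(W_t)` stopped at `imgLocTimeK n`, clock `Cⁿ = imgClockK κ hA hne n`) with the
localised compensated restriction martingale `Lᵏ = locMartK κ α λ hA hne k` (`h_t′(W_t)^α e^{−λ∫m}` stopped at
`locTimeK k`) is an `𝓕`-martingale of the driving Brownian motion** — in print Itô:
`d(ZL) = Z dL + L dZ + d⟨Z, L⟩`, `dZ = 2W̃ dW̃ + (d⟨W̃⟩ − κ h′(W)² dt)`, the `dt`-terms being
`2 W̃ L h″(W) (κ/2 − 3 + κα) = 0`.

Last file of Σ, sequel of `…TiltedBracketCell` / `…TiltedBracketPieces` / `…TiltedBracketEstimate` (cell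
scheme) and `…TiltedBracketFrozen` / `…TiltedBracketMoment` / `…TiltedBracketInterior` (frozen second
moment): summing the cell estimate `abs_setIntegral_brkCell_le` over a uniform partition of `[s, t]`
(`abs_setIntegral_brk_sub_le_of_partition`, with the interior constants of `exists_abs_integral_mul_brkSq_le` and
`exists_abs_integral_mul_prod_le` at horizon `t`), letting the mesh go to `0` and then the oscillation
threshold `κ₀ → 0` gives `∫_S (Z_t L_t − Z_s L_s) = 0` for `S ∈ 𝓕_s` (`setIntegral_brk_sub_eq_zero`), whence
the martingale (`martingale_brk_mul_locMartK`, registered form `stub_tiltedBracketMartingale`).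

References: [LSW] §5 (5.1)–(5.3), Prop. 5.3; G. F. Lawler, O. Schramm, W. Werner, Acta Math. **187** (2001),
Thm. 2.2 (the bracket at `κ = 6`). No named fact is used.
-/

noncomputable section

open MeasureTheory Filter Topology Set Metric Function
open scoped NNReal ENNReal
open Literature.Probability.RandomPlanarGeometry
open Literature.Probability.Process (preWienerMeasure runSup)

namespace Summit.CriticalPhenomena.SAWScalingLimit.Theorems.SubseqIdentification.BoundaryAreaLaw

open Loewner PathOps

variable {κ : ℝ≥0} {α lam : ℝ} (hκ0 : 0 < κ) (hκ : κ ≤ 8 / 3) (hαdef : α = (6 - κ) / (2 * κ))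
  (hlamdef : lam = (8 - 3 * κ) * (6 - κ) / (2 * κ))
  {A : Set ℂ} {hA : IsStarHull A} {hne : A.Nonempty} {n k : ℕ}

/-! ### Telescoping over a partition -/

section Partition

variable [MeasurableSpace C(ℝ≥0, ℝ)] [BorelSpace C(ℝ≥0, ℝ)]

-- matching the explicit cell bound against the abbreviated summands for every cell needs slightly more than the
-- default heartbeats (the sum itself is elementary)
include hκ0 hκ hαdef hlamdef in
set_option maxHeartbeats 400000 in
/-- **Summing the bracket cell estimates over a uniform partition of `[s, t]` into `N` cells of length `h`**
(`t ≤ t₁`, the horizon of the interior constants `C_A`, `C_B`; the boundary events of `imgLocTimeK n` over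
distinct cells are disjoint). [folklore] -/
theorem abs_setIntegral_brk_sub_le_of_partition (hnk : n ≤ k) {R : ℝ} (hR0 : 0 < R) (hAR : A ⊆ closedBall (0 : ℂ) R)
    {t₁ : ℝ≥0} {CA CB : ℝ}
    (hCA : ∀ (u h : ℝ≥0), u ≤ t₁ → 0 < h →
      (h : ℝ) ≤ 3 * (locLevel n / 2 * (locLevel n / 16) / 4000) ^ 2 / 256 → lam * (h * massBdCell n) ≤ 1 →
      ∀ {g : (ℝ≥0 → ℝ) → ℝ}, Measurable[brownianFiltration u] g → (∀ ω, g ω ∈ Icc (0 : ℝ) 1) →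
        (∀ ω, g ω ≠ 0 → (u : WithTop ℝ≥0) < imgLocTimeK κ hA hne n ω) →
        |∫ ω, g ω * ((imageDrvFnK κ A (u + h) (brownianCPath ω) - imageDrvFnK κ A u (brownianCPath ω)) ^ 2 *
              (DFnK κ A (u + h) (brownianCPath ω) ^ α * Real.exp (-(lam * JFnK κ A u h (brownianCPath ω)))) -
            κ * starDeriv (slidHull (drvK κ (brownianCPath ω)) A u) ^ 2 *
              starDeriv (slidHull (drvK κ (brownianCPath ω)) A u) ^ α * h) ∂preWienerMeasure| ≤ CA * h * Real.sqrt h)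
    (hCB : ∀ (u h : ℝ≥0), u ≤ t₁ → 0 < h →
      (h : ℝ) ≤ 3 * (locLevel n / 2 * (locLevel n / 16) / 4000) ^ 2 / 256 → lam * (h * massBdCell n) ≤ 1 →
      ∀ {g : (ℝ≥0 → ℝ) → ℝ}, Measurable[brownianFiltration u] g → (∀ ω, g ω ∈ Icc (0 : ℝ) 1) →
        (∀ ω, g ω ≠ 0 → (u : WithTop ℝ≥0) < imgLocTimeK κ hA hne n ω) →
        |∫ ω, g ω * ((imageDrvFnK κ A (u + h) (brownianCPath ω) - imageDrvFnK κ A u (brownianCPath ω)) *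
            (DFnK κ A (u + h) (brownianCPath ω) ^ α * Real.exp (-(lam * JFnK κ A u h (brownianCPath ω)))))
            ∂preWienerMeasure| ≤ CB * h * Real.sqrt h)
    {s t : ℝ≥0} (hst : s ≤ t) (ht₁ : t ≤ t₁) {S : Set (ℝ≥0 → ℝ)} (hS : MeasurableSet[brownianFiltration s] S)
    {κ₀ : ℝ} (hκ₀ : 0 < κ₀) {N : ℕ} {h : ℝ≥0} (hhN : (N : ℝ≥0) * h = t - s) (hh0 : 0 < h) (hh1 : (h : ℝ) ≤ 1)
    (hhc : (h : ℝ) ≤ 3 * (locLevel n / 2 * (locLevel n / 16) / 4000) ^ 2 / 256)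
    (hh2 : stepSize κ₀ h ≤ locLevel n * (locLevel n / 16) / 1000) (hh5 : lam * (h * massBdCell n) ≤ 1) :
    |∫ ω in S, ((imgMartK κ hA hne n t ω ^ 2 - κ * imgClockK κ hA hne n t ω) * locMartK κ α lam hA hne k t ω -
        (imgMartK κ hA hne n s ω ^ 2 - κ * imgClockK κ hA hne n s ω) * locMartK κ α lam hA hne k s ω) ∂preWienerMeasure| ≤
      N * ((CA + 6 * (((n : ℝ) + 1) + 1160 * (3 * ((n : ℝ) + 1) + 13 * Real.sqrt ((n : ℝ) + 1) + R)) * CB +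
          κ * stepCK α lam (locLevel n / 2) (locLevel n / 16)) * h * Real.sqrt h) +
        (3 * (50 * (h : ℝ) / (locLevel n / 16) + 4 * κ₀) ^ 2 +
            4 * (((n : ℝ) + 1) + 1160 * (3 * ((n : ℝ) + 1) + 13 * Real.sqrt ((n : ℝ) + 1) + R)) *
              (50 * (h : ℝ) / (locLevel n / 16) + 4 * κ₀) + 2 * κ * h) +
        N * (2 * κ * h * cellErr n κ₀ h) +
        N * ((((2 * (((n : ℝ) + 1) + 1160 * (3 * ((n : ℝ) + 1) + 13 * Real.sqrt ((n : ℝ) + 1) + R)) ^ 2 + 3 * κ +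
                2 * (15080 * Real.sqrt ((t₁ : ℝ) + 1) + 1160 * R) ^ 2 +
              2 * (((n : ℝ) + 1) + 1160 * (3 * ((n : ℝ) + 1) + 13 * Real.sqrt ((n : ℝ) + 1) + R)) *
                (15080 * Real.sqrt ((t₁ : ℝ) + 1) + 1160 * R)) +
              2 * (((n : ℝ) + 1) + 1160 * (3 * ((n : ℝ) + 1) + 13 * Real.sqrt ((n : ℝ) + 1) + R)) * (3482 * Real.sqrt κ) +
              2 * (3482 * Real.sqrt κ) ^ 2) * (768 / (κ₀ / stepSigma) ^ 8) +
          (2 * (((n : ℝ) + 1) + 1160 * (3 * ((n : ℝ) + 1) + 13 * Real.sqrt ((n : ℝ) + 1) + R)) * (3482 * Real.sqrt κ) +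
              2 * (3482 * Real.sqrt κ) ^ 2) * (18 * ((t₁ : ℝ) + 1) ^ 2)) * (h : ℝ) ^ 2) := by
  -- adapted from SLEImageBracketMartingale.lean (`abs_setIntegral_imgBracket_sub_le_of_partition`)
  haveI := isProbabilityMeasure_preWienerMeasure'
  obtain ⟨hαpos, hlam0⟩ := exponents_pos hκ hαdef hlamdef hκ0
  have hc0 := (locLevel_pos_le n).1
  have hSm : MeasurableSet S := brownianFiltration.le s _ hS
  set X : ℝ≥0 → (ℝ≥0 → ℝ) → ℝ := fun r ω ↦ (imgMartK κ hA hne n r ω ^ 2 - κ * imgClockK κ hA hne n r ω) *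
    locMartK κ α lam hA hne k r ω with hX
  set N₀ : ℝ := ((n : ℝ) + 1) + 1160 * (3 * ((n : ℝ) + 1) + 13 * Real.sqrt ((n : ℝ) + 1) + R) with hN₀
  set C₁ : ℝ := (CA + 6 * N₀ * CB + κ * stepCK α lam (locLevel n / 2) (locLevel n / 16)) * h * Real.sqrt h with hC₁
  set Dv : ℝ := 3 * (50 * (h : ℝ) / (locLevel n / 16) + 4 * κ₀) ^ 2 + 4 * N₀ * (50 * (h : ℝ) / (locLevel n / 16) + 4 * κ₀) +
    2 * κ * h with hDv
  set C₂ : ℝ := 2 * κ * h * cellErr n κ₀ h with hC₂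
  set K : ℝ := (((2 * N₀ ^ 2 + 3 * κ + 2 * (15080 * Real.sqrt ((t₁ : ℝ) + 1) + 1160 * R) ^ 2 +
      2 * N₀ * (15080 * Real.sqrt ((t₁ : ℝ) + 1) + 1160 * R)) + 2 * N₀ * (3482 * Real.sqrt κ) + 2 * (3482 * Real.sqrt κ) ^ 2) *
      (768 / (κ₀ / stepSigma) ^ 8) +
    (2 * N₀ * (3482 * Real.sqrt κ) + 2 * (3482 * Real.sqrt κ) ^ 2) * (18 * ((t₁ : ℝ) + 1) ^ 2)) * (h : ℝ) ^ 2 with hK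
  have hN₀0 : 0 ≤ N₀ := by positivity
  have hDv0 : 0 ≤ Dv := by positivity
  set u : ℕ → ℝ≥0 := fun i ↦ s + (i : ℝ≥0) * h with hu
  have hu0 : u 0 = s := by simp [hu]
  have huN : u N = t := by rw [hu]; simp only; rw [hhN, add_tsub_cancel_of_le hst]
  have husucc : ∀ i, u (i + 1) = u i + h := fun i ↦ by simp only [hu]; push_cast; ring
  have hsu : ∀ i, s ≤ u i := fun i ↦ by simp only [hu]; exact le_self_add
  have hut : ∀ i, i < N → u i ≤ t₁ := fun i hi ↦ by
    refine le_trans ?_ ht₁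
    rw [← huN]; simp only [hu]
    gcongr
  -- telescoping
  have hint : ∀ i, Integrable (X (u i)) preWienerMeasure := fun i ↦ integrable_brk_mul_locMartK hαpos hlam0 _
  have htel : ∫ ω in S, (X t ω - X s ω) ∂preWienerMeasure =
      ∑ i ∈ Finset.range N, ∫ ω in S, (X (u (i + 1)) ω - X (u i) ω) ∂preWienerMeasure := by
    have e1 : (fun ω ↦ X t ω - X s ω) = fun ω ↦ ∑ i ∈ Finset.range N, (X (u (i + 1)) ω - X (u i) ω) := by
      funext ω; rw [Finset.sum_range_sub (fun i ↦ X (u i) ω), huN, hu0]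
    have hint' : ∀ i ∈ Finset.range N, Integrable (fun ω ↦ X (u (i + 1)) ω - X (u i) ω) (preWienerMeasure.restrict S) :=
      fun i _ ↦ ((hint (i + 1)).sub (hint i)).integrableOn
    rw [e1]
    exact integral_finsetSum (Finset.range N) (f := fun i ω ↦ X (u (i + 1)) ω - X (u i) ω) hint'
  show |∫ ω in S, (X t ω - X s ω) ∂preWienerMeasure| ≤ N * C₁ + Dv + N * C₂ + N * K
  rw [htel]
  -- the boundary events are pairwise disjoint
  set E : ℕ → Set (ℝ≥0 → ℝ) := fun i ↦ {ω | ((u i : ℝ≥0) : WithTop ℝ≥0) < imgLocTimeK κ hA hne n ω ∧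
    imgLocTimeK κ hA hne n ω < ((u i + h : ℝ≥0) : WithTop ℝ≥0)} with hE
  have hEm : ∀ i, MeasurableSet (E i) := fun i ↦ by
    obtain ⟨-, h1, h2⟩ := measurableSet_lt_imgLocTimeK (κ := κ) (hA := hA) (hne := hne) n (u i) (u i + h)
    exact h1.inter h2
  have hdisj : Set.PairwiseDisjoint (↑(Finset.range N) : Set ℕ) E := by
    intro i _ j _ hij
    rw [Function.onFun, Set.disjoint_left]
    rintro ω ⟨hi1, hi2⟩ ⟨hj1, hj2⟩
    have hh0' : (0 : ℝ) < h := hh0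
    have hji : u j < u i + h := by have := hj1.trans hi2; exact_mod_cast this
    have hij' : u i < u j + h := by have := hi1.trans hj2; exact_mod_cast this
    have hji_r : (s : ℝ) + j * h < s + i * h + h := by have := hji; simp only [hu] at this; exact_mod_cast this
    have hij_r : (s : ℝ) + i * h < s + j * h + h := by have := hij'; simp only [hu] at this; exact_mod_cast this
    rcases lt_or_gt_of_ne hij with hlt | hlt
    · have : (i : ℝ) + 1 ≤ j := by exact_mod_cast hlt
      nlinarith
    · have : (j : ℝ) + 1 ≤ i := by exact_mod_cast hlt
      nlinarith
  have hsumE : ∑ i ∈ Finset.range N, preWienerMeasure.real (E i) ≤ 1 := by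
    have := sum_measureReal_le_measureReal_univ (μ := preWienerMeasure) (s := Finset.range N) (fun i _ ↦ hEm i) hdisj
    rwa [probReal_univ] at this
  -- sum the cell estimates
  have hcell : ∀ i ∈ Finset.range N, |∫ ω in S, (X (u (i + 1)) ω - X (u i) ω) ∂preWienerMeasure| ≤
      C₁ + Dv * preWienerMeasure.real (E i) + C₂ + K := fun i hi ↦ by
    rw [husucc]
    exact abs_setIntegral_brkCell_le hκ0 hκ hαdef hlamdef hnk hR0 hAR hCA hCB (hsu i) (hut i (Finset.mem_range.1 hi)) hS hκ₀ hh0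
      hh1 hhc hh2 hh5
  calc |∑ i ∈ Finset.range N, ∫ ω in S, (X (u (i + 1)) ω - X (u i) ω) ∂preWienerMeasure|
      ≤ ∑ i ∈ Finset.range N, |∫ ω in S, (X (u (i + 1)) ω - X (u i) ω) ∂preWienerMeasure| := Finset.abs_sum_le_sum_abs _ _
    _ ≤ ∑ i ∈ Finset.range N, (C₁ + Dv * preWienerMeasure.real (E i) + C₂ + K) := Finset.sum_le_sum hcell
    _ = N * C₁ + Dv * ∑ i ∈ Finset.range N, preWienerMeasure.real (E i) + N * C₂ + N * K := by
        rw [Finset.sum_add_distrib, Finset.sum_add_distrib, Finset.sum_add_distrib, Finset.sum_const, Finset.sum_const,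
          Finset.sum_const, Finset.card_range, ← Finset.mul_sum]
        simp [nsmul_eq_mul]
    _ ≤ _ := by
        have := mul_le_mul_of_nonneg_left hsumE hDv0
        linarith

end Partition

/-! ### The increments of `Zⁿ · Lᵏ` integrate to zero over `𝓕_s`-events -/

section Zero

include hκ0 hκ hαdef hlamdef in
/-- **`∫_S (Z_t L_t − Z_s L_s) = 0` for `s ≤ t`, `S ∈ 𝓕_s`, `n ≤ k`**: let the mesh of the partition go to `0`
(the sum of the cell bounds tends to `48κ₀² + 16N₀κ₀ + 2κ(t − s)(2κ₀/(cₙ/16))`), then the oscillation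
threshold `κ₀ → 0`. [cite: LawlerSchrammWerner2003Restriction, §5 (5.1)–(5.3) and Prop. 5.3] -/
theorem setIntegral_brk_sub_eq_zero (hnk : n ≤ k) {s t : ℝ≥0} (hst : s ≤ t) {S : Set (ℝ≥0 → ℝ)}
    (hS : MeasurableSet[brownianFiltration s] S) :
    ∫ ω in S, ((imgMartK κ hA hne n t ω ^ 2 - κ * imgClockK κ hA hne n t ω) * locMartK κ α lam hA hne k t ω -
        (imgMartK κ hA hne n s ω ^ 2 - κ * imgClockK κ hA hne n s ω) * locMartK κ α lam hA hne k s ω) ∂preWienerMeasure = 0 := by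
  -- adapted from SLEImageBracketMartingale.lean (`setIntegral_imgBracket_sub_eq_zero`) and …TiltedProductMartingale
  letI : MeasurableSpace C(ℝ≥0, ℝ) := borel _
  haveI : BorelSpace C(ℝ≥0, ℝ) := ⟨rfl⟩
  rcases hst.eq_or_lt with heq | hst'
  · subst heq; simp
  obtain ⟨hc0, hc1⟩ := locLevel_pos_le n
  have hσ := stepSigma_pos
  set c := locLevel n with hc
  -- the radius of `A` and the interior constants at horizon `t`
  obtain ⟨R₁, hR₁⟩ := hA.isBoundedHull.isCompact.isBounded.subset_closedBall (0 : ℂ)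
  set R : ℝ := max R₁ 1 with hR
  have hR0 : 0 < R := lt_max_of_lt_right one_pos
  have hAR : A ⊆ closedBall (0 : ℂ) R := hR₁.trans (closedBall_subset_closedBall (le_max_left _ _))
  obtain ⟨CA, -, hCA⟩ := exists_abs_integral_mul_brkSq_le hκ0 hκ hαdef hlamdef hA hne n hR0 hAR t
  obtain ⟨CB, -, hCB⟩ := exists_abs_integral_mul_prod_le hκ0 hκ hαdef hlamdef hA hne n hR0 hAR t
  set N₀ : ℝ := ((n : ℝ) + 1) + 1160 * (3 * ((n : ℝ) + 1) + 13 * Real.sqrt ((n : ℝ) + 1) + R) with hN₀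
  set I : ℝ := ∫ ω in S, ((imgMartK κ hA hne n t ω ^ 2 - κ * imgClockK κ hA hne n t ω) * locMartK κ α lam hA hne k t ω -
    (imgMartK κ hA hne n s ω ^ 2 - κ * imgClockK κ hA hne n s ω) * locMartK κ α lam hA hne k s ω) ∂preWienerMeasure with hI
  have hts : (0 : ℝ) < (t : ℝ) - s := by have : (s : ℝ) < t := (by exact_mod_cast hst'); linarith
  -- the mesh `h_N = (t - s)/(N + 1)` and its limits
  set hN : ℕ → ℝ≥0 := fun N ↦ (t - s) / ((N : ℝ≥0) + 1) with hhN
  have hhN' : ∀ N : ℕ, (((N + 1 : ℕ) : ℝ≥0)) * hN N = t - s := fun N ↦ by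
    simp only [hhN]; push_cast; rw [mul_div_cancel₀ _ (by positivity)]
  have hcoe : ∀ N : ℕ, (hN N : ℝ) = ((t : ℝ) - s) / ((N : ℝ) + 1) := fun N ↦ by
    simp only [hhN]; push_cast [NNReal.coe_sub hst]; ring
  have hh_pos : ∀ N, 0 < hN N := fun N ↦ by
    have : (0 : ℝ) < hN N := by rw [hcoe]; positivity
    exact_mod_cast this
  have hh_tend : Tendsto (fun N ↦ (hN N : ℝ)) atTop (𝓝 0) := by
    simp_rw [hcoe]
    exact tendsto_const_nhds.div_atTop (tendsto_natCast_atTop_atTop.atTop_add tendsto_const_nhds)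
  have hsqrt_tend : Tendsto (fun N ↦ Real.sqrt (hN N)) atTop (𝓝 0) := by
    have := (Real.continuous_sqrt.tendsto 0).comp hh_tend
    rwa [Function.comp_def, Real.sqrt_zero] at this
  have hNh : ∀ N : ℕ, ((N + 1 : ℕ) : ℝ) * (hN N : ℝ) = (t : ℝ) - s := fun N ↦ by
    rw [hcoe]; push_cast; field_simp
  -- Step 1: for every small `κ₀ > 0`, `|I| ≤ L(κ₀)`
  have step1 : ∀ κ₀ : ℝ, 0 < κ₀ → κ₀ ≤ c * (c / 16) / 2000 →
      |I| ≤ 3 * (4 * κ₀) ^ 2 + 4 * N₀ * (4 * κ₀) + 2 * κ * ((t : ℝ) - s) * (2 * κ₀ / (c / 16)) := by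
    intro κ₀ hκ₀ hκc
    set C₀ : ℝ := CA + 6 * N₀ * CB + κ * stepCK α lam (c / 2) (c / 16) with hC₀
    set K : ℝ := (((2 * N₀ ^ 2 + 3 * κ + 2 * (15080 * Real.sqrt ((t : ℝ) + 1) + 1160 * R) ^ 2 +
        2 * N₀ * (15080 * Real.sqrt ((t : ℝ) + 1) + 1160 * R)) + 2 * N₀ * (3482 * Real.sqrt κ) + 2 * (3482 * Real.sqrt κ) ^ 2) *
        (768 / (κ₀ / stepSigma) ^ 8) +
      (2 * N₀ * (3482 * Real.sqrt κ) + 2 * (3482 * Real.sqrt κ) ^ 2) * (18 * ((t : ℝ) + 1) ^ 2)) with hK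
    set RHS : ℕ → ℝ := fun N ↦ ((N + 1 : ℕ) : ℝ) * (C₀ * hN N * Real.sqrt (hN N)) +
        (3 * (50 * (hN N : ℝ) / (c / 16) + 4 * κ₀) ^ 2 + 4 * N₀ * (50 * (hN N : ℝ) / (c / 16) + 4 * κ₀) + 2 * κ * (hN N : ℝ)) +
        ((N + 1 : ℕ) : ℝ) * (2 * κ * hN N * cellErr n κ₀ (hN N)) + ((N + 1 : ℕ) : ℝ) * (K * (hN N : ℝ) ^ 2) with hRHS
    have hRHS_eq : ∀ N, RHS N = C₀ * ((t : ℝ) - s) * Real.sqrt (hN N) +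
        (3 * (50 * (hN N : ℝ) / (c / 16) + 4 * κ₀) ^ 2 + 4 * N₀ * (50 * (hN N : ℝ) / (c / 16) + 4 * κ₀) + 2 * κ * (hN N : ℝ)) +
        2 * κ * ((t : ℝ) - s) * cellErr n κ₀ (hN N) + K * ((t : ℝ) - s) * (hN N : ℝ) := fun N ↦ by
      simp only [hRHS]
      have e := hNh N
      have e1 : ((N + 1 : ℕ) : ℝ) * (C₀ * hN N * Real.sqrt (hN N)) = C₀ * (((N + 1 : ℕ) : ℝ) * hN N) * Real.sqrt (hN N) := by ring
      have e2 : ((N + 1 : ℕ) : ℝ) * (2 * κ * hN N * cellErr n κ₀ (hN N)) = 2 * κ * (((N + 1 : ℕ) : ℝ) * hN N) * cellErr n κ₀ (hN N) := by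
        ring
      have e3 : ((N + 1 : ℕ) : ℝ) * (K * (hN N : ℝ) ^ 2) = K * (((N + 1 : ℕ) : ℝ) * hN N) * hN N := by ring
      rw [e1, e2, e3, e]
    have hce : Tendsto (fun N ↦ cellErr n κ₀ (hN N)) atTop (𝓝 (50 * 0 / (c / 16) ^ 2 + 2 * (κ₀ + 4 * 0) / (c / 16))) := by
      have : (fun N ↦ cellErr n κ₀ (hN N)) = fun N ↦ 50 * (hN N : ℝ) / (c / 16) ^ 2 + 2 * (κ₀ + 4 * Real.sqrt (hN N)) / (c / 16) := by
        funext N; rw [cellErr, stepSize]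
      rw [this]
      exact ((tendsto_const_nhds.mul hh_tend).div_const _).add
        ((tendsto_const_nhds.mul (tendsto_const_nhds.add (tendsto_const_nhds.mul hsqrt_tend))).div_const _)
    rw [mul_zero, zero_div, zero_add, mul_zero, add_zero] at hce
    have hlim : Tendsto RHS atTop (𝓝 (3 * (4 * κ₀) ^ 2 + 4 * N₀ * (4 * κ₀) + 2 * κ * ((t : ℝ) - s) * (2 * κ₀ / (c / 16)))) := by
      have h1 : Tendsto (fun N ↦ C₀ * ((t : ℝ) - s) * Real.sqrt (hN N)) atTop (𝓝 0) := by
        have := tendsto_const_nhds (x := C₀ * ((t : ℝ) - s)) |>.mul hsqrt_tend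
        rwa [mul_zero] at this
      have h2 : Tendsto (fun N ↦ 3 * (50 * (hN N : ℝ) / (c / 16) + 4 * κ₀) ^ 2 + 4 * N₀ * (50 * (hN N : ℝ) / (c / 16) + 4 * κ₀) +
          2 * κ * (hN N : ℝ)) atTop (𝓝 (3 * (50 * 0 / (c / 16) + 4 * κ₀) ^ 2 + 4 * N₀ * (50 * 0 / (c / 16) + 4 * κ₀) + 2 * κ * 0)) := by
        have hd : Tendsto (fun N ↦ 50 * (hN N : ℝ) / (c / 16) + 4 * κ₀) atTop (𝓝 (50 * 0 / (c / 16) + 4 * κ₀)) :=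
          ((tendsto_const_nhds.mul hh_tend).div_const _).add tendsto_const_nhds
        exact ((tendsto_const_nhds.mul (hd.pow 2)).add (tendsto_const_nhds.mul hd)).add (tendsto_const_nhds.mul hh_tend)
      rw [mul_zero, zero_div, zero_add, mul_zero, add_zero] at h2
      have h3 : Tendsto (fun N ↦ 2 * κ * ((t : ℝ) - s) * cellErr n κ₀ (hN N)) atTop (𝓝 (2 * κ * ((t : ℝ) - s) * (2 * κ₀ / (c / 16)))) :=
        tendsto_const_nhds.mul hce
      have h4 : Tendsto (fun N ↦ K * ((t : ℝ) - s) * (hN N : ℝ)) atTop (𝓝 0) := by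
        have := tendsto_const_nhds (x := K * ((t : ℝ) - s)) |>.mul hh_tend
        rwa [mul_zero] at this
      have := ((h1.add h2).add h3).add h4
      rw [zero_add, add_zero] at this
      exact this.congr fun N ↦ (hRHS_eq N).symm
    -- eventually all smallness conditions hold, and then `|I| ≤ RHS N`
    have hK1 : (0 : ℝ) < 3 * (c / 2 * (c / 16) / 4000) ^ 2 / 256 := by positivity
    have hK2 : (0 : ℝ) < c * (c / 16) / 8000 := by positivity
    have h5t : Tendsto (fun N ↦ lam * (hN N * massBdCell n)) atTop (𝓝 0) := by
      have := (tendsto_const_nhds (x := lam)).mul (hh_tend.mul (tendsto_const_nhds (x := massBdCell n)))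
      rwa [zero_mul, mul_zero] at this
    have hev : ∀ᶠ N in atTop, |I| ≤ RHS N := by
      filter_upwards [hh_tend.eventually (eventually_le_nhds hK1), hh_tend.eventually (eventually_le_nhds one_pos),
        hsqrt_tend.eventually (eventually_le_nhds hK2), h5t.eventually (eventually_le_nhds one_pos)] with N h1 h1' h2b h5
      have hh2 : stepSize κ₀ (hN N) ≤ c * (c / 16) / 1000 := by rw [stepSize]; linarith
      exact abs_setIntegral_brk_sub_le_of_partition (hA := hA) (hne := hne) (n := n) (k := k) hκ0 hκ hαdef hlamdef hnk hR0 hAR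
        hCA hCB hst le_rfl hS hκ₀ (N := N + 1) (hhN' N) (hh_pos N) h1' h1 hh2 h5
    exact ge_of_tendsto hlim hev
  -- Step 2: `κ₀ → 0`
  have hL : Tendsto (fun κ₀ : ℝ ↦ 3 * (4 * κ₀) ^ 2 + 4 * N₀ * (4 * κ₀) + 2 * κ * ((t : ℝ) - s) * (2 * κ₀ / (c / 16))) (𝓝[>] 0) (𝓝 0) := by
    have h1 : Tendsto (fun κ₀ : ℝ ↦ 3 * (4 * κ₀) ^ 2 + 4 * N₀ * (4 * κ₀) + 2 * κ * ((t : ℝ) - s) * (2 * κ₀ / (c / 16))) (𝓝 0)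
        (𝓝 (3 * (4 * 0) ^ 2 + 4 * N₀ * (4 * 0) + 2 * κ * ((t : ℝ) - s) * (2 * 0 / (c / 16)))) := by
      have hk : Tendsto (fun κ₀ : ℝ ↦ κ₀) (𝓝 0) (𝓝 0) := tendsto_id
      exact ((tendsto_const_nhds.mul ((tendsto_const_nhds.mul hk).pow 2)).add (tendsto_const_nhds.mul (tendsto_const_nhds.mul hk))).add
        (tendsto_const_nhds.mul ((tendsto_const_nhds.mul hk).div_const _))
    rw [mul_zero, zero_pow two_ne_zero, mul_zero, mul_zero, mul_zero, zero_div, mul_zero, add_zero, add_zero] at h1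
    exact h1.mono_left nhdsWithin_le_nhds
  have hevκ : ∀ᶠ κ₀ in 𝓝[>] (0 : ℝ), |I| ≤ 3 * (4 * κ₀) ^ 2 + 4 * N₀ * (4 * κ₀) + 2 * κ * ((t : ℝ) - s) * (2 * κ₀ / (c / 16)) := by
    have hpos : ∀ᶠ κ₀ in 𝓝[>] (0 : ℝ), 0 < κ₀ := eventually_mem_nhdsWithin
    have hsmall : ∀ᶠ κ₀ in 𝓝[>] (0 : ℝ), κ₀ ≤ c * (c / 16) / 2000 :=
      (eventually_le_nhds (by positivity : (0 : ℝ) < c * (c / 16) / 2000)).filter_mono nhdsWithin_le_nhds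
    filter_upwards [hpos, hsmall] with κ₀ h1 h2
    exact step1 κ₀ h1 h2
  exact abs_nonpos_iff.1 (ge_of_tendsto hL hevκ)

end Zero

/-! ### The martingale -/

section Mart

include hκ0 hκ hαdef hlamdef in
/-- **[LSW] §5 ((5.1)–(5.3) with Prop. 5.3), the bracket identity `Σ` of the tilted Theorem 6.5, localised:**
for `0 < κ ≤ 8/3`, `α = (6 − κ)/(2κ)`, `λ = (8 − 3κ)(6 − κ)/(2κ)`, every nonempty `*`-hull `A` and levels `n ≤ k`,
the product `((Mⁿ)² − κ Cⁿ) · Lᵏ` of the compensated square of the localised image driving function `h_t(W_t)`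
(stopped at `imgLocTimeK n`, clock `Cⁿ = ∫ h_s′(W_s)² ds`) with the localised compensated restriction martingale
`h_t′(W_t)^α e^{−λ∫m}` (stopped at `locTimeK k`) is a bounded `𝓕`-martingale of the SLE_κ driving Brownian
motion: the bracket `d⟨W̃⟩ = κ h′(W)² dt` survives the tilt by `Y`. [cite: LawlerSchrammWerner2003Restriction, §5 (5.1)–(5.3) and Prop. 5.3] -/
theorem martingale_brk_mul_locMartK (hnk : n ≤ k) :
    Martingale (fun t ω ↦ (imgMartK κ hA hne n t ω ^ 2 - κ * imgClockK κ hA hne n t ω) * locMartK κ α lam hA hne k t ω)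
      brownianFiltration preWienerMeasure := by
  -- adapted from …TiltedProductMartingale (`martingale_imgMartK_mul_locMartK`)
  haveI := isProbabilityMeasure_preWienerMeasure'
  obtain ⟨hαpos, hlam0⟩ := exponents_pos hκ hαdef hlamdef hκ0
  refine ⟨stronglyAdapted_brk_mul_locMartK hαpos, fun i j hij ↦ ?_⟩
  have hm : brownianFiltration i ≤ (inferInstance : MeasurableSpace (ℝ≥0 → ℝ)) := brownianFiltration.le i
  haveI : IsFiniteMeasure (preWienerMeasure.trim hm) := isFiniteMeasure_trim hm
  refine (ae_eq_condExp_of_forall_setIntegral_eq hm (integrable_brk_mul_locMartK hαpos hlam0 j)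
    (fun S _ _ ↦ (integrable_brk_mul_locMartK hαpos hlam0 i).integrableOn) (fun S hS _ ↦ ?_)
    ((stronglyAdapted_brk_mul_locMartK (κ := κ) (hA := hA) (hne := hne) (n := n) (k := k) hαpos i).aestronglyMeasurable)).symm
  have h0 := setIntegral_brk_sub_eq_zero (hA := hA) (hne := hne) (n := n) (k := k) hκ0 hκ hαdef hlamdef hnk hij hS
  rw [integral_sub (integrable_brk_mul_locMartK hαpos hlam0 j).integrableOn (integrable_brk_mul_locMartK hαpos hlam0 i).integrableOn,
    sub_eq_zero] at h0
  exact h0.symm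

end Mart

section Registered

/-- **Registered form (stub `stub_tiltedBracketMartingale`, Σ, of the reshaped line skeleton r-c4-5)**:
for all `0 < κ ≤ 8/3`, `α = (6−κ)/(2κ)`, `λ = (8−3κ)(6−κ)/(2κ)`, every nonempty `A ∈ 𝒬*` and levels `n ≤ k`,
`((Mⁿ)² − κ Cⁿ) · Lᵏ = (imgMartK κ hA hne n ^ 2 − κ · imgClockK κ hA hne n) · locMartK κ α λ hA hne k` is a martingale
of the Brownian filtration. [cite: LawlerSchrammWerner2003Restriction, §5 (5.1)–(5.3) and Prop. 5.3] -/
theorem stub_tiltedBracketMartingale :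
    ∀ (κ : ℝ≥0) (α lam : ℝ), 0 < κ → κ ≤ 8 / 3 → α = (6 - κ) / (2 * κ) →
      lam = (8 - 3 * κ) * (6 - κ) / (2 * κ) → ∀ (A : Set ℂ) (hA : IsStarHull A) (hne : A.Nonempty) (n k : ℕ), n ≤ k →
      Martingale (fun t ω => (imgMartK κ hA hne n t ω ^ 2 - κ * imgClockK κ hA hne n t ω) *
        locMartK κ α lam hA hne k t ω) brownianFiltration preWienerMeasure :=
  fun _ _ _ hκ0 hκ hαdef hlamdef _ _ _ _ _ hnk ↦ martingale_brk_mul_locMartK hκ0 hκ hαdef hlamdef hnk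

end Registered

end Summit.CriticalPhenomena.SAWScalingLimit.Theorems.SubseqIdentification.BoundaryAreaLaw

end
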